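import Summits.QuantumAdvantage.QuantumAdvantage.Theorems.CubicForrelationNearExactIsExactTwelveZ512Line

/-!
# Crux `CubicForrelation.NearExactIsExact` (stmt-QuantumAdvantage-14043) — n = 12, level-`≥ 6` side with a 9-flat even set on the OPEN
  window: (H4) on the flat when `4 ∣ e` off `Z`, and the set `L = {λ odd}` is empty or has `≥ 64` points

Certificate seat `b2b-cforr-cert` (gen 27).  HONEST FRAMING: finite-slice lemmas (standard axioms) about cubic Boolean pairs on 12 bits; bricks for
the partner-free perturbation bound of …TwelveZ512PiBound.  NO value of `θ₁₂` is claimed; NOT summit progress.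

Setting.  Cubic `f, g`, `W_g = 64u''`, `e := u'' − (−1)^f`, `Z := {u'' even} = x_Z ⊕ V₀` a 9-flat, off-flat energy `E_off ≤ 383`, `σ = (−1)^{hb}` the
(affine, …TwelveZ512SignAffine) mod-4 sign of `e` on `Z`, `λ := (e − σ)/4` on `Z`, `L := {x ∈ Z : λ odd}`.
* `tzc_avoid3`: three transversal directions whose seven non-trivial combinations keep a `2^k`-point family of `Z` away from `Z ∪ A`, whenever
  `2^k·#A ≤ 508`.
* `tzc_H4`: if `4 ∣ e` off `Z`, then `8 ∣ Σ_{4-flat ⊂ Z} e` (the off-flat points with `8 ∤ e` cost `16` each, so there are `≤ 23`; the 7-flat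
  `x ⊕ ⟨t₁,t₂,t₃,a₀..a₃⟩` has sum `≡ 0 (mod 8)` by `tw15_e_flat7` and its 112 outer points carry `8 ∣ e`).
* `tzc_sigma_sum4`: `8 ∣ Σ_{4-flat ⊂ Z} σ` (`ws_sum4_mod8` with the vanishing relative form of `tza_hsd`).
* `tzc_L_card`: if `4 ∣ e` off `Z` then `λ` has even 4-flat sums on `Z`, so `#L = 0` or `#L ≥ 64` (`ws_erm_round`, `r = 3`).

References: J. Ax (1964) / R. J. McEliece (1972); MacWilliams–Sloane (1977) Ch. 13 §3, Ch. 15 §2.  Axioms: the standard three.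
-/

set_option linter.dupNamespace false -- D-0017: single-problem summit ⇒ `QuantumAdvantage.QuantumAdvantage` by design

noncomputable section

namespace Summit.QuantumAdvantage.QuantumAdvantage.Theorems.CubicForrelation.NearExactIsExact

open Finset
open Literature.Computability.QuantumComplexity
open Literature.Computability.QuantumComplexity.BuzetChailloux (bxor zeroVec bxor_bxor_cancel_left bxor_zeroVec zeroVec_bxor bxor_comm
  bxor_self)
open Literature.Computability.QuantumComplexity.DerivativeWalsh (W)

/-! ### (H4) when `4 ∣ e` off `Z` -/

/-- **Three avoiding transversal directions for a 16-point family** (`2^k·#A ≤ 508`). [this work] -/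
theorem tzc_avoid3 (V₀ S : Finset (Fin (6 + 6) → Bool)) (xZ : Fin (6 + 6) → Bool)
    (hadd : ∀ a ∈ V₀, ∀ b ∈ V₀, bxor a b ∈ V₀) (hcardV : #V₀ = 512) (hS : S = V₀.image (bxor xZ))
    (A : Finset (Fin (6 + 6) → Bool)) {k : ℕ} (hkA : 2 ^ k * #A ≤ 508)
    (pt : (Fin k → Bool) → (Fin (6 + 6) → Bool)) (hpt : ∀ ε, pt ε ∈ S) :
    ∃ t₁ t₂ t₃ : Fin (6 + 6) → Bool, ∀ ε : Fin k → Bool,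
      (bxor (pt ε) t₁ ∉ S ∧ bxor (pt ε) t₁ ∉ A) ∧ (bxor (pt ε) t₂ ∉ S ∧ bxor (pt ε) t₂ ∉ A) ∧
      (bxor (bxor (pt ε) t₂) t₁ ∉ S ∧ bxor (bxor (pt ε) t₂) t₁ ∉ A) ∧ (bxor (pt ε) t₃ ∉ S ∧ bxor (pt ε) t₃ ∉ A) ∧
      (bxor (bxor (pt ε) t₃) t₁ ∉ S ∧ bxor (bxor (pt ε) t₃) t₁ ∉ A) ∧ (bxor (bxor (pt ε) t₃) t₂ ∉ S ∧ bxor (bxor (pt ε) t₃) t₂ ∉ A) ∧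
      (bxor (bxor (bxor (pt ε) t₃) t₂) t₁ ∉ S ∧ bxor (bxor (bxor (pt ε) t₃) t₂) t₁ ∉ A) := by
  classical
  set Bad₀ := (univ : Finset (Fin k → Bool)).biUnion (fun ε => A.image (bxor (pt ε))) with hBad₀
  have hBad₀card : #Bad₀ ≤ 508 := by
    calc #Bad₀ ≤ ∑ ε : Fin k → Bool, #(A.image (bxor (pt ε))) := card_biUnion_le
      _ ≤ ∑ ε : Fin k → Bool, #A := sum_le_sum fun ε _ => card_image_le
      _ = 2 ^ k * #A := by rw [sum_const, card_univ, Fintype.card_fun, Fintype.card_bool, Fintype.card_fin, smul_eq_mul]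
      _ ≤ 508 := hkA
  set F₁ := V₀ ∪ Bad₀ with hF₁
  have hF₁card : #F₁ ≤ 1020 := (card_union_le _ _).trans (by rw [hcardV]; omega)
  have hgood : ∀ w, w ∉ F₁ → ∀ ε, bxor (pt ε) w ∉ S ∧ bxor (pt ε) w ∉ A := by
    intro w hw ε
    rw [hF₁, mem_union, not_or] at hw
    refine ⟨fun h => hw.1 (gh_mem_dir V₀ S xZ hadd hS (hpt ε) h), fun h => hw.2 ?_⟩
    exact mem_biUnion.2 ⟨ε, mem_univ _, mem_image.2 ⟨bxor (pt ε) w, h, bxor_bxor_cancel_left _ _⟩⟩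
  have hshift : ∀ w t : Fin (6 + 6) → Bool, w ∉ F₁.image (fun z => bxor z t) → bxor w t ∉ F₁ := by
    intro w t hw hmem
    exact hw (mem_image.2 ⟨bxor w t, hmem, by rw [iw_bxor_assoc, bxor_self, bxor_zeroVec]⟩)
  have hshift2 : ∀ w t t' : Fin (6 + 6) → Bool, w ∉ F₁.image (fun z => bxor (bxor z t') t) → bxor (bxor w t) t' ∉ F₁ := by
    intro w t t' hw hmem
    exact hw (mem_image.2 ⟨bxor (bxor w t) t', hmem, by
      rw [iw_bxor_assoc (bxor w t), bxor_self, bxor_zeroVec, iw_bxor_assoc, bxor_self, bxor_zeroVec]⟩)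
  have huniv : #(univ : Finset (Fin (6 + 6) → Bool)) = 4096 := by
    rw [card_univ, Fintype.card_fun, Fintype.card_bool, Fintype.card_fin]; norm_num
  obtain ⟨t₁, -, ht₁⟩ : ∃ t, t ∈ univ ∧ t ∉ F₁ := exists_mem_notMem_of_card_lt_card (by rw [huniv]; omega)
  obtain ⟨t₂, -, ht₂⟩ : ∃ t, t ∈ univ ∧ t ∉ F₁ ∪ F₁.image (fun z => bxor z t₁) :=
    exists_mem_notMem_of_card_lt_card (by
      have h1 := card_union_le F₁ (F₁.image (fun z => bxor z t₁))
      have h2 : #(F₁.image (fun z => bxor z t₁)) ≤ 1020 := card_image_le.trans hF₁card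
      rw [huniv]; omega)
  rw [mem_union, not_or] at ht₂
  obtain ⟨t₃, -, ht₃⟩ : ∃ t, t ∈ univ ∧
      t ∉ ((F₁ ∪ F₁.image (fun z => bxor z t₁)) ∪ F₁.image (fun z => bxor z t₂)) ∪ F₁.image (fun z => bxor (bxor z t₁) t₂) :=
    exists_mem_notMem_of_card_lt_card (by
      have h1 := card_union_le F₁ (F₁.image (fun z => bxor z t₁))
      have h2 : #(F₁.image (fun z => bxor z t₁)) ≤ 1020 := card_image_le.trans hF₁card
      have h3 := card_union_le (F₁ ∪ F₁.image (fun z => bxor z t₁)) (F₁.image (fun z => bxor z t₂))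
      have h4 : #(F₁.image (fun z => bxor z t₂)) ≤ 1020 := card_image_le.trans hF₁card
      have h5 := card_union_le ((F₁ ∪ F₁.image (fun z => bxor z t₁)) ∪ F₁.image (fun z => bxor z t₂))
        (F₁.image (fun z => bxor (bxor z t₁) t₂))
      have h6 : #(F₁.image (fun z => bxor (bxor z t₁) t₂)) ≤ 1020 := card_image_le.trans hF₁card
      rw [huniv]; omega)
  simp only [mem_union, not_or] at ht₃
  obtain ⟨⟨⟨ht₃₀, ht₃₁⟩, ht₃₂⟩, ht₃₂₁⟩ := ht₃
  refine ⟨t₁, t₂, t₃, fun ε => ⟨hgood t₁ ht₁ ε, hgood t₂ ht₂.1 ε, ?_, hgood t₃ ht₃₀ ε, ?_, ?_, ?_⟩⟩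
  · rw [iw_bxor_assoc]; exact hgood _ (hshift t₂ t₁ ht₂.2) ε
  · rw [iw_bxor_assoc]; exact hgood _ (hshift t₃ t₁ ht₃₁) ε
  · rw [iw_bxor_assoc]; exact hgood _ (hshift t₃ t₂ ht₃₂) ε
  · rw [iw_bxor_assoc (pt ε), iw_bxor_assoc (pt ε)]
    exact hgood _ (hshift2 t₃ t₂ t₁ ht₃₂₁) ε

/-- **(H4) on the 9-flat when `4 ∣ e` off `Z`**: `8 ∣ Σ_{4-flat ⊂ Z} e` (off-flat energy `≤ 383`: the `≤ 23` off-flat points with `8 ∤ e`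
are avoided by three transversal directions; `tw15_e_flat7`). [this work] -/
theorem tzc_H4 (f g : (Fin (6 + 6) → Bool) → Bool) (hf : IsDegLeFun 3 f) (hg : IsDegLeFun 3 g)
    (u'' : (Fin (6 + 6) → Bool) → ℤ) (hu'' : ∀ x, W (fun y => signOf (g y)) x = (2 : ℝ) ^ 6 * (u'' x : ℝ))
    (V₀ : Finset (Fin (6 + 6) → Bool)) (xZ : Fin (6 + 6) → Bool) (h0 : zeroVec ∈ V₀)
    (hadd : ∀ a ∈ V₀, ∀ b ∈ V₀, bxor a b ∈ V₀) (hcardV : #V₀ = 512)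
    (hS : (univ.filter fun x : Fin (6 + 6) → Bool => ¬ Odd (u'' x)) = V₀.image (bxor xZ))
    (hoff : ∑ y ∈ univ.filter (fun y => y ∉ (univ.filter fun x : Fin (6 + 6) → Bool => ¬ Odd (u'' x))), (u'' y - sZ (f y)) ^ 2 ≤ 383)
    (h4off : ∀ y, y ∉ (univ.filter fun x : Fin (6 + 6) → Bool => ¬ Odd (u'' x)) → (4 : ℤ) ∣ u'' y - sZ (f y))
    (x : Fin (6 + 6) → Bool) (hx : x ∈ (univ.filter fun x : Fin (6 + 6) → Bool => ¬ Odd (u'' x)))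
    (a₀ a₁ a₂ a₃ : Fin (6 + 6) → Bool) (ha₀ : a₀ ∈ V₀) (ha₁ : a₁ ∈ V₀) (ha₂ : a₂ ∈ V₀) (ha₃ : a₃ ∈ V₀) :
    (8 : ℤ) ∣ ∑ ε : Fin 4 → Bool, (u'' (fun j => x j ^^ decide (Odd #(univ.filter fun i =>
        ε i && (![a₀, a₁, a₂, a₃] : Fin 4 → Fin (6 + 6) → Bool) i j))) - sZ (f (fun j => x j ^^ decide (Odd #(univ.filter fun i =>
        ε i && (![a₀, a₁, a₂, a₃] : Fin 4 → Fin (6 + 6) → Bool) i j))))) := by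
  classical
  set Z := univ.filter (fun x : Fin (6 + 6) → Bool => ¬ Odd (u'' x)) with hZdef
  set e : (Fin (6 + 6) → Bool) → ℤ := fun x => u'' x - sZ (f x) with hedef
  show (8 : ℤ) ∣ ∑ ε : Fin 4 → Bool, e (fun j => x j ^^ decide (Odd #(univ.filter fun i =>
        ε i && (![a₀, a₁, a₂, a₃] : Fin 4 → Fin (6 + 6) → Bool) i j)))
  have h4off' : ∀ y, y ∉ Z → (4 : ℤ) ∣ e y := h4off
  set A := (univ.filter fun y : Fin (6 + 6) → Bool => y ∉ Z ∧ ¬ (8 : ℤ) ∣ u'' y - sZ (f y)) with hAdef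
  -- each point of `A` costs `≥ 16`
  have hAcard : #A ≤ 23 := by
    have hcost : ∀ y ∈ A, (16 : ℤ) ≤ e y ^ 2 := by
      intro y hy
      obtain ⟨hyZ, hy8⟩ := (mem_filter.1 hy).2
      obtain ⟨m, hm⟩ := h4off' y hyZ
      have hm0 : ¬ (2 : ℤ) ∣ m := by
        rintro ⟨m', rfl⟩
        exact hy8 ⟨m', by change e y = _ ; rw [hm]; ring⟩
      have : e y ≤ -4 ∨ 4 ≤ e y := by omega
      have := tp_sq_ge (k := 4) (by norm_num) this
      linarith
    have hAsub : A ⊆ univ.filter (fun y => y ∉ Z) := fun y hy => mem_filter.2 ⟨mem_univ _, (mem_filter.1 hy).2.1⟩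
    have h16 : (16 : ℤ) * #A ≤ 383 := by
      calc (16 : ℤ) * #A = ∑ y ∈ A, (16 : ℤ) := by rw [sum_const, nsmul_eq_mul, mul_comm]
        _ ≤ ∑ y ∈ A, e y ^ 2 := sum_le_sum hcost
        _ ≤ ∑ y ∈ univ.filter (fun y => y ∉ Z), e y ^ 2 := sum_le_sum_of_subset_of_nonneg hAsub fun _ _ _ => sq_nonneg _
        _ ≤ 383 := hoff
    have : (#A : ℤ) ≤ 23 := by omega
    exact_mod_cast this
  have hPV : ∀ x, x ∈ Z → ∀ a ∈ V₀, bxor x a ∈ Z := fun x hx a ha => fl1_coset_vadd hadd hS hx ha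
  -- the truncation `F'` agrees with `e` mod 8 and vanishes at the good points
  set F' : (Fin (6 + 6) → Bool) → ℤ := fun y => if (y ∈ Z ∨ ¬ (8 : ℤ) ∣ e y) then e y else 0 with hF'
  have hdiffF : ∀ y, (8 : ℤ) ∣ e y - F' y := by
    intro y
    by_cases hy : (y ∈ Z ∨ ¬ (8 : ℤ) ∣ e y)
    · simp only [F', if_pos hy, sub_self]; exact dvd_zero _
    · simp only [F', if_neg hy, sub_zero]
      rw [not_or, not_not] at hy
      exact hy.2
  have hF'Z : ∀ y, y ∈ Z → F' y = e y := fun y hy => by simp only [F', if_pos (Or.inl hy)]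
  have hGF : ∀ y, y ∉ Z → y ∉ A → F' y = 0 := by
    intro y hy hyA
    have h8 : (8 : ℤ) ∣ e y := by
      by_contra h8
      exact hyA (mem_filter.2 ⟨mem_univ _, hy, h8⟩)
    simp only [F']
    rw [if_neg]
    rw [not_or, not_not]
    exact ⟨hy, h8⟩
  -- the inner 4-flat and three avoiding directions
  set pt : (Fin 4 → Bool) → (Fin (6 + 6) → Bool) :=
    fun ε => (fun j => x j ^^ decide (Odd #(univ.filter fun i => ε i && (![a₀, a₁, a₂, a₃] : Fin 4 → Fin (6 + 6) → Bool) i j))) with hptdef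
  have hin : ∀ ε, pt ε ∈ Z := fun ε => fr_mem_flatPt4 V₀ h0 (· ∈ Z) hPV hx ![a₀, a₁, a₂, a₃] (fun i => by fin_cases i <;> assumption) ε
  obtain ⟨t₁, t₂, t₃, hgood⟩ := tzc_avoid3 V₀ Z xZ hadd hcardV hS A (k := 4) (by norm_num; omega) pt hin
  have hloc := ep_loc3 F' x t₁ t₂ t₃ ![a₀, a₁, a₂, a₃]
    (fun ε => hGF _ (hgood ε).1.1 (hgood ε).1.2) (fun ε => hGF _ (hgood ε).2.1.1 (hgood ε).2.1.2)
    (fun ε => hGF _ (hgood ε).2.2.1.1 (hgood ε).2.2.1.2) (fun ε => hGF _ (hgood ε).2.2.2.1.1 (hgood ε).2.2.2.1.2)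
    (fun ε => hGF _ (hgood ε).2.2.2.2.1.1 (hgood ε).2.2.2.2.1.2) (fun ε => hGF _ (hgood ε).2.2.2.2.2.1.1 (hgood ε).2.2.2.2.2.1.2)
    (fun ε => hGF _ (hgood ε).2.2.2.2.2.2.1 (hgood ε).2.2.2.2.2.2.2)
  -- the 7-flat sum of `F'` is `≡ 0 (mod 8)`
  have h7 := tw15_e_flat7 f g hf hg u'' hu'' x ![t₁, t₂, t₃, a₀, a₁, a₂, a₃]
  have h7' : (8 : ℤ) ∣ ∑ ε : Fin 7 → Bool, F' (fun j => x j ^^ decide (Odd #(univ.filter fun i =>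
      ε i && (![t₁, t₂, t₃, a₀, a₁, a₂, a₃] : Fin 7 → Fin (6 + 6) → Bool) i j))) := by
    have hd : (8 : ℤ) ∣ ∑ ε : Fin 7 → Bool, ((u'' (fun j => x j ^^ decide (Odd #(univ.filter fun i =>
        ε i && (![t₁, t₂, t₃, a₀, a₁, a₂, a₃] : Fin 7 → Fin (6 + 6) → Bool) i j))) - sZ (f (fun j => x j ^^ decide (Odd #(univ.filter fun i =>
        ε i && (![t₁, t₂, t₃, a₀, a₁, a₂, a₃] : Fin 7 → Fin (6 + 6) → Bool) i j))))) -
        F' (fun j => x j ^^ decide (Odd #(univ.filter fun i =>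
        ε i && (![t₁, t₂, t₃, a₀, a₁, a₂, a₃] : Fin 7 → Fin (6 + 6) → Bool) i j)))) := dvd_sum fun ε _ => hdiffF _
    rw [sum_sub_distrib] at hd
    have := dvd_sub h7 hd
    simpa using this
  have e7 : (![t₁, t₂, t₃, a₀, a₁, a₂, a₃] : Fin 7 → Fin (6 + 6) → Bool) =
      Matrix.vecCons t₁ (Matrix.vecCons t₂ (Matrix.vecCons t₃ ![a₀, a₁, a₂, a₃])) := rfl
  rw [e7, hloc] at h7'
  rw [sum_congr rfl fun ε _ => hF'Z _ (hin ε)] at h7'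
  exact h7'

/-! ### `σ` affine ⇒ `8 ∣ Σ_{4-flat} σ`; (H4) ⇒ `#L ∈ {0} ∪ [64, ∞)` -/

/-- **`8 ∣ Σ_{4-flat ⊂ Z} σ`** for the affine mod-4 sign (`ws_sum4_mod8` with vanishing relative form). [this work] -/
theorem tzc_sigma_sum4 (f g : (Fin (6 + 6) → Bool) → Bool) (hf : IsDegLeFun 3 f) (hg : IsDegLeFun 3 g)
    (u'' : (Fin (6 + 6) → Bool) → ℤ) (hu'' : ∀ x, W (fun y => signOf (g y)) x = (2 : ℝ) ^ 6 * (u'' x : ℝ))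
    (V₀ : Finset (Fin (6 + 6) → Bool)) (xZ : Fin (6 + 6) → Bool) (h0 : zeroVec ∈ V₀)
    (hadd : ∀ a ∈ V₀, ∀ b ∈ V₀, bxor a b ∈ V₀) (hcardV : #V₀ = 512)
    (hS : (univ.filter fun x : Fin (6 + 6) → Bool => ¬ Odd (u'' x)) = V₀.image (bxor xZ))
    (hoff : ∑ y ∈ univ.filter (fun y => y ∉ (univ.filter fun x : Fin (6 + 6) → Bool => ¬ Odd (u'' x))), (u'' y - sZ (f y)) ^ 2 ≤ 511)
    (x : Fin (6 + 6) → Bool) (hx : x ∈ (univ.filter fun x : Fin (6 + 6) → Bool => ¬ Odd (u'' x)))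
    (a₀ a₁ a₂ a₃ : Fin (6 + 6) → Bool) (ha₀ : a₀ ∈ V₀) (ha₁ : a₁ ∈ V₀) (ha₂ : a₂ ∈ V₀) (ha₃ : a₃ ∈ V₀) :
    (8 : ℤ) ∣ ∑ ε : Fin 4 → Bool, sZ (decide ((u'' (fun j => x j ^^ decide (Odd #(univ.filter fun i =>
        ε i && (![a₀, a₁, a₂, a₃] : Fin 4 → Fin (6 + 6) → Bool) i j))) - sZ (f (fun j => x j ^^ decide (Odd #(univ.filter fun i =>
        ε i && (![a₀, a₁, a₂, a₃] : Fin 4 → Fin (6 + 6) → Bool) i j))))) % 4 = 3)) := by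
  classical
  set Z := univ.filter (fun x : Fin (6 + 6) → Bool => ¬ Odd (u'' x)) with hZdef
  set hb : (Fin (6 + 6) → Bool) → Bool := fun x => decide ((u'' x - sZ (f x)) % 4 = 3) with hbdef
  obtain ⟨hB, hsd⟩ := tza_hsd f g hf hg u'' hu'' V₀ xZ h0 hadd hcardV hS hoff
  have hPV : ∀ x, x ∈ Z → ∀ a ∈ V₀, bxor x a ∈ Z := fun x hx a ha => fl1_coset_vadd hadd hS hx ha
  have h := ws_sum4_mod8 V₀ (· ∈ Z) xZ hb hPV hsd hx ha₀ ha₁ ha₂ ha₃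
  rw [hB a₁ ha₁ a₀ ha₀, hB a₃ ha₃ a₂ ha₂, hB a₂ ha₂ a₀ ha₀, hB a₃ ha₃ a₁ ha₁, hB a₃ ha₃ a₀ ha₀, hB a₂ ha₂ a₁ ha₁] at h
  simp only [Bool.false_and, Bool.false_xor, Bool.false_eq_true, if_false] at h
  exact Int.dvd_of_emod_eq_zero h

/-- **`#L = 0` or `#L ≥ 64`** for `L = {x ∈ Z : λ odd}`, `λ = (e − σ)/4`, when `4 ∣ e` off `Z` (off-flat energy `≤ 383`): `σ` is affine and
(H4) holds, so `λ` has even 4-flat sums on the 9-flat (`ws_erm_round`, `r = 3`). [this work] -/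
theorem tzc_L_card (f g : (Fin (6 + 6) → Bool) → Bool) (hf : IsDegLeFun 3 f) (hg : IsDegLeFun 3 g)
    (u'' : (Fin (6 + 6) → Bool) → ℤ) (hu'' : ∀ x, W (fun y => signOf (g y)) x = (2 : ℝ) ^ 6 * (u'' x : ℝ))
    (V₀ : Finset (Fin (6 + 6) → Bool)) (xZ : Fin (6 + 6) → Bool) (h0 : zeroVec ∈ V₀)
    (hadd : ∀ a ∈ V₀, ∀ b ∈ V₀, bxor a b ∈ V₀) (hcardV : #V₀ = 512)
    (hS : (univ.filter fun x : Fin (6 + 6) → Bool => ¬ Odd (u'' x)) = V₀.image (bxor xZ))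
    (hoff : ∑ y ∈ univ.filter (fun y => y ∉ (univ.filter fun x : Fin (6 + 6) → Bool => ¬ Odd (u'' x))), (u'' y - sZ (f y)) ^ 2 ≤ 383)
    (h4off : ∀ y, y ∉ (univ.filter fun x : Fin (6 + 6) → Bool => ¬ Odd (u'' x)) → (4 : ℤ) ∣ u'' y - sZ (f y)) :
    #((univ.filter fun x : Fin (6 + 6) → Bool => ¬ Odd (u'' x)).filter fun x =>
        Odd ((u'' x - sZ (f x) - sZ (decide ((u'' x - sZ (f x)) % 4 = 3))) / 4)) = 0 ∨
    64 ≤ #((univ.filter fun x : Fin (6 + 6) → Bool => ¬ Odd (u'' x)).filter fun x =>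
        Odd ((u'' x - sZ (f x) - sZ (decide ((u'' x - sZ (f x)) % 4 = 3))) / 4)) := by
  classical
  set Z := univ.filter (fun x : Fin (6 + 6) → Bool => ¬ Odd (u'' x)) with hZdef
  set e : (Fin (6 + 6) → Bool) → ℤ := fun x => u'' x - sZ (f x) with hedef
  set hb : (Fin (6 + 6) → Bool) → Bool := fun x => decide (e x % 4 = 3) with hbdef
  have hcardV9 : #V₀ = 2 ^ 9 := by rw [hcardV]; norm_num
  have hmemZ : ∀ x, x ∈ V₀.image (bxor xZ) ↔ x ∈ Z := fun x => by rw [hS]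
  have hPV : ∀ x, x ∈ Z → ∀ a ∈ V₀, bxor x a ∈ Z := fun x hx a ha => fl1_coset_vadd hadd hS hx ha
  have hoff' : ∑ y ∈ univ.filter (fun y => y ∉ Z), e y ^ 2 ≤ 511 := hoff.trans (by norm_num)
  have hdec : ∀ z ∈ Z, e z = sZ (hb z) + 4 * ((e z - sZ (hb z)) / 4) := fun z hz => by
    have h := Int.mul_ediv_cancel' (tza_mod4 f u'' hz)
    change 4 * ((e z - sZ (hb z)) / 4) = e z - sZ (hb z) at h
    linarith
  set ψ : (Fin (6 + 6) → Bool) → ℤ := fun z => (e z - sZ (hb z)) / 4 with hψ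
  have H : ∀ b ∈ V₀.image (bxor xZ), ∀ a : Fin (3 + 1) → Fin (6 + 6) → Bool, (∀ i, a i ∈ V₀) →
      (2 : ℤ) ∣ ∑ ε : Fin (3 + 1) → Bool, ψ (fun j => b j ^^ decide (Odd #(univ.filter fun i => ε i && a i j))) := by
    intro b hb' a ha
    have hbZ := (hmemZ b).1 hb'
    have ea : a = ![a 0, a 1, a 2, a 3] := by funext i; fin_cases i <;> rfl
    have h8 := tzc_H4 f g hf hg u'' hu'' V₀ xZ h0 hadd hcardV hS hoff h4off b hbZ (a 0) (a 1) (a 2) (a 3) (ha 0) (ha 1) (ha 2) (ha 3)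
    have hσ := tzc_sigma_sum4 f g hf hg u'' hu'' V₀ xZ h0 hadd hcardV hS hoff' b hbZ (a 0) (a 1) (a 2) (a 3) (ha 0) (ha 1) (ha 2) (ha 3)
    rw [← ea] at h8 hσ
    change (8 : ℤ) ∣ ∑ ε : Fin (3 + 1) → Bool, e (fun j => b j ^^ decide (Odd #(univ.filter fun i => ε i && a i j))) at h8
    change (8 : ℤ) ∣ ∑ ε : Fin (3 + 1) → Bool, sZ (hb (fun j => b j ^^ decide (Odd #(univ.filter fun i => ε i && a i j)))) at hσ
    have hpts : ∀ ε : Fin (3 + 1) → Bool, (fun j => b j ^^ decide (Odd #(univ.filter fun i => ε i && a i j))) ∈ Z :=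
      fun ε => fr_mem_flatPt4 V₀ h0 (· ∈ Z) hPV hbZ a ha ε
    rw [sum_congr rfl fun ε _ => hdec _ (hpts ε), sum_add_distrib, ← mul_sum] at h8
    have h4ψ : (8 : ℤ) ∣ 4 * ∑ ε : Fin (3 + 1) → Bool, ψ (fun j => b j ^^ decide (Odd #(univ.filter fun i => ε i && a i j))) :=
      (dvd_add_right hσ).1 h8
    obtain ⟨q, hq⟩ := h4ψ
    exact ⟨q, by linarith⟩
  rcases ws_erm_round V₀ h0 hadd hcardV9 xZ ψ 3 H with hall | hbig
  · left
    rw [card_eq_zero]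
    refine filter_eq_empty_iff.2 fun z hz hz' => ?_
    have hE := hall z ((hmemZ z).2 hz)
    exact (Int.not_odd_iff_even.2 hE) hz'
  · right
    change 64 ≤ #(Z.filter fun x => Odd ((e x - sZ (hb x)) / 4))
    have e1 : ((V₀.image (bxor xZ)).filter fun z => Odd (ψ z)) = Z.filter (fun x => Odd ((e x - sZ (hb x)) / 4)) := by
      rw [← hS]
    rw [e1] at hbig
    norm_num at hbig
    omega

end Summit.QuantumAdvantage.QuantumAdvantage.Theorems.CubicForrelation.NearExactIsExact

end
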